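import Summits.QuantumFields.BalabanUV.Beta.D1BFx.CoframeJetDipoleMass
import Summits.QuantumFields.BalabanUV.Beta.D1BFx.KernelMassCalculus

/-!
# `BalabanUV.Beta.D1BFx.CoframeJetDipoleLetters` — road «BF-x» for BINDER row D1, slot (K), binder (C1) «TB4-W CO-FRAME FIRST JET,
# m-UNIFORM MASS»: THE (C1) ROW AT ONE SCALE FROM THREE LEG LETTERS IN gan24-leaf-05's `ColMass` CURRENCY (part 3 of «COFRAME-JET-DIPOLE»)

HONEST DEPENDENCY (page 1, mandatory): continuum YM on T⁴ ⇐ BetaPertH ∧ nine spine estimates (0/9 proved); BetaPertH ⇐ (D1) ∧ (D4) ∧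
CAP+tail; G-an2-4 gates asym, D1 and NE2/3/4.  HONEST FRAMING (cell contract, verbatim): «discharging `BetaPertH` makes Bałaban's UV
stability UNCONDITIONAL — a real constructive-QFT result; it is NOT the continuum limit and NOT the Clay problem.»  THIS FILE DISCHARGES
NOTHING of D1 / BetaPertH: [folklore] `ℓ¹` bookkeeping over the road's OWN typed objects in gan24-leaf-05's currency
(`KernelMassCalculus.ColMass`, p330141 ✓).  It proves NO estimate of Bałaban's and NO letter of `Pgt`; it does NOT close (C1): it brings
part 2's three-letter reduction `CoframeJetDipoleMass.tBw₁_weighted_mass_le_of_col` to the LEG letters the (γ)∕δ′ lane states —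
the column mass `g₀` of `Ggh n a`, the column masses `g₁` of its row-gradients (β2 `GhostLegProfile.exists_Ggh_masses`: `g₁ = O(1∕n)` on
`n = L^k`, IN THE TREE) and the column masses `p₁` of the row-gradients of `Pgt n a` (part 4 `ProjectorGradientMass` derives them from `g₁` through
γ2's `Pgt = n⁻⁴•((gqK∘csqK)∘gqKᵀ)`) — by pure algebra: `R = idK − P`,
`R∘G′ = G′ − P∘G′`, `∇_α(A∘B) = (∇_αA)∘B`, `ColMass` subadditivity and `colMass_comp`.  0∕4 row-D1 binders discharged; (K) NOT closed;
NOT D1, NOT BetaPertH, NOT continuum, NOT Clay.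

WHAT IS HERE (unit `b2b-balaban-beta-d1-formalise-leaf-03`, gen 25, INTENT-1 «COFRAME-JET-DIPOLE» l.44044, part 3 of 5; the row-gradient
kernel `∇_α K := (x,y) ↦ K(x+e_α,y) − K(x,y)` is written INLINE as a lambda, no `def`):
* §1 `rowGrad_sub` (`∇_α(K − L) = ∇_αK − ∇_αL`), `rowGrad_comp` (`∇_α(A∘B) = (∇_αA)∘B` for tame `A B`, `slices_tame` + `tsum_sub`).
* §2 the `Unit`-fibre bridge `colLetter_of_colMass`: four per-direction `ColMass (∇_α K) s c` letters give part 2's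
  explicit column-gradient letter with constant `4·c`.
* §3 the letters of `idK`, `R`, `R∘G′`: `colMass_rowGrad_idK : ColMass (∇_α idK) s (1 + e^{s})`; `colMass_rowGrad_Rgt : ColMass (∇_α R) s
  (1 + e^{s} + p₁)` (`R = idK − P`, `CoframeJetProjection.Pgt_eq_idK_sub`); `comp_Rgt_Ggh_eq : R∘G′ = G′ − P∘G′`; `colMass_rowGrad_comp_Rgt_Ggh : ColMass (∇_α (R∘G′)) s (g₁ + p₁·g₀)`.
* §4 **`tBw₁_weighted_mass_le_of_leg_letters (ha : 0 < a) (hs : 0 ≤ s) (hG₀ : ColMass (Ggh n a) s g₀) (hG₁ : ∀ α, ColMass (∇_α (Ggh n a)) s g₁)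
  (hP₁ : ∀ α, ColMass (∇_α (Pgt n a)) s p₁)` : PART 14's (C1) summand at scale `n`, rate `s`, is summable with
  `Σ' … ≤ 16·e^{s}·(8·n²·p₁·(g₁ + p₁·g₀) + (1 + e^{s} + p₁))`.**  LOCATED COUNT (the theorem is part 5 `CoframeJetMassScales.exists_C1_letters`):
  `g₀ = O(1)`, `g₁ = O(1∕n)` (β2 ✓), `p₁ = O(1∕n)` (part 4) at `s = σV∕n ≤ δ∕(8n)`, `σV < δ_C∕4` ⟹ `n²·p₁·(g₁ + p₁g₀) = O(1)`, k-free.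

No `def`, no `def … : Prop`, nothing cited as mathematics.
-/

noncomputable section

namespace Summit.QuantumFields.BalabanUV.Beta.D1BFx.CoframeJetDipoleLetters

open Literature.MathematicalPhysics.QuantumFieldTheory.Balaban1983to89
open Literature.MathematicalPhysics.QuantumFieldTheory.Balaban1983to89.Beta
open B12Sec2to5 (l1 l1_nonneg)
open ExpKernelCalculus (Site MKer comp l1_sub_symm)
open AffineAveraging (unitVec)
open HessKerSchurResolvent (idK idK_apply comp_idK_left)
open Summit.QuantumFields.BalabanUV.Beta.TameKernelCalculus (Tame Spr spr_idK slices_tame comp_sub_left_tame)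
open Summit.QuantumFields.BalabanUV.Beta.D1BFx.GhostStencil (l1_unitVec l1_zero)
open Summit.QuantumFields.BalabanUV.Beta.D1BFx.GhostStencilReflection (add_unitVec_ne_self)
open Summit.QuantumFields.BalabanUV.Beta.D1BFx.GhostLeg (Ggh tame_Ggh)
open Summit.QuantumFields.BalabanUV.Beta.D1BFx.RProjector (Pgt)
open Summit.QuantumFields.BalabanUV.Beta.D1BFx.RJetProjector (Rgt)
open Summit.QuantumFields.BalabanUV.Beta.D1BFx.LandauMultiplierMean (spr_Pgt)
open Summit.QuantumFields.BalabanUV.Beta.D1BFx.TorusWeightWordTwisted (tBw₁)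
open Summit.QuantumFields.BalabanUV.Beta.D1BFx.CoframeJetProjection (Pgt_eq_idK_sub)
open Summit.QuantumFields.BalabanUV.Beta.D1BFx.CoframeJetDipole (summable_and_tsum_le_of_le ind_summable_and_tsum_le weight_self)
open Summit.QuantumFields.BalabanUV.Beta.D1BFx.CoframeJetDipoleMass (tBw₁_weighted_mass_le_of_col)
open Summit.QuantumFields.BalabanUV.Beta.D1BFx.KernelMassCalculus (rowFn ColMass colMass_comp)

/-! ## §1 Row-gradient kernels: two algebraic identities -/

/-- [folklore] `∇_α (K − L) = ∇_α K − ∇_α L` (pointwise). -/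
theorem rowGrad_sub (K L : MKer 4 Unit) (α : Fin 4) :
    (fun x y (v w : Unit) => (K - L) (x + unitVec α) y v w - (K - L) x y v w)
      = (fun x y (v w : Unit) => K (x + unitVec α) y v w - K x y v w) - (fun x y (v w : Unit) => L (x + unitVec α) y v w - L x y v w) := by
  funext x y v w
  simp only [Pi.sub_apply]
  ring

/-- [folklore] **`∇_α (A ∘ B) = (∇_α A) ∘ B`** for tame `A`, `B` (the two defining series converge absolutely: `slices_tame`). -/
theorem rowGrad_comp {A B : MKer 4 Unit} (hA : Tame A) (hB : Tame B) (α : Fin 4) :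
    (fun x z (v w : Unit) => comp A B (x + unitVec α) z v w - comp A B x z v w)
      = comp (fun x y (v w : Unit) => A (x + unitVec α) y v w - A x y v w) B := by
  funext x z v w
  show (∑' y, ∑ f, A (x + unitVec α) y v f * B y z f w) - (∑' y, ∑ f, A x y v f * B y z f w)
    = ∑' y, ∑ f, (A (x + unitVec α) y v f - A x y v f) * B y z f w
  rw [← (slices_tame hA hB (x + unitVec α) z v w).tsum_sub (slices_tame hA hB x z v w)]
  refine tsum_congr fun y => ?_
  rw [← Finset.sum_sub_distrib]
  refine Finset.sum_congr rfl fun f _ => ?_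
  ring

/-! ## §2 The `Unit`-fibre bridge to part 2's explicit letters -/

/-- [folklore] **FOUR PER-DIRECTION `ColMass` LETTERS GIVE THE EXPLICIT COLUMN-GRADIENT LETTER** (constant `4·c`). -/
theorem colLetter_of_colMass {K : MKer 4 Unit} {s c : ℝ}
    (h : ∀ α : Fin 4, ColMass (fun x y (v w : Unit) => K (x + unitVec α) y v w - K x y v w) s c) (y : Site 4) :
    (Summable fun x => (∑ α, |K (x + unitVec α) y () () - K x y () ()|) * Real.exp (s * l1 (x - y))) ∧
    ∑' x, (∑ α, |K (x + unitVec α) y () () - K x y () ()|) * Real.exp (s * l1 (x - y)) ≤ 4 * c := by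
  have hα : ∀ α : Fin 4, (Summable fun x => |K (x + unitVec α) y () () - K x y () ()| * Real.exp (s * l1 (x - y))) ∧
      ∑' x, |K (x + unitVec α) y () () - K x y () ()| * Real.exp (s * l1 (x - y)) ≤ c := fun α => by
    have h1 := h α y
    unfold KernelMassCalculus.rowFn at h1
    simp only [Finset.univ_unique, PUnit.default_eq_unit, Finset.sum_singleton] at h1
    exact h1
  have e : (fun x => (∑ α, |K (x + unitVec α) y () () - K x y () ()|) * Real.exp (s * l1 (x - y)))
      = fun x => ∑ α, |K (x + unitVec α) y () () - K x y () ()| * Real.exp (s * l1 (x - y)) := by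
    funext x
    rw [Finset.sum_mul]
  rw [e]
  refine ⟨summable_sum fun α _ => (hα α).1, ?_⟩
  rw [Summable.tsum_finsetSum (fun α _ => (hα α).1)]
  calc ∑ α : Fin 4, ∑' x, |K (x + unitVec α) y () () - K x y () ()| * Real.exp (s * l1 (x - y))
      ≤ ∑ _α : Fin 4, c := Finset.sum_le_sum fun α _ => (hα α).2
    _ = 4 * c := by simp [Finset.sum_const, Finset.card_univ, Fintype.card_fin]

/-! ## §3 The letters of `idK`, `R = idK − P` and `R ∘ G′ = G′ − P ∘ G′` -/

/-- [folklore] **THE IDENTITY's GRADIENT LETTER**: `ColMass (∇_α idK) s (1 + e^{s})` (two entries per column: `x = y` with weight `1`,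
`x = y − e_α` with weight `e^{s}`). -/
theorem colMass_rowGrad_idK (s : ℝ) (α : Fin 4) :
    ColMass (fun x y (v w : Unit) => (idK : MKer 4 Unit) (x + unitVec α) y v w - (idK : MKer 4 Unit) x y v w) s (1 + Real.exp s) := by
  intro y
  unfold KernelMassCalculus.rowFn
  simp only [Finset.univ_unique, PUnit.default_eq_unit, Finset.sum_singleton]
  have hne : y - unitVec α ≠ y := fun h => add_unitVec_ne_self (y - unitVec α) α (by rw [sub_add_cancel]; exact h.symm)
  -- the two-indicator majorant
  have hind1 := ind_summable_and_tsum_le (y - unitVec α)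
  have hind0 := ind_summable_and_tsum_le y
  have hG : Summable fun x : Site 4 => Real.exp s * (if x = y - unitVec α then (1 : ℝ) else 0) + (if x = y then (1 : ℝ) else 0) :=
    (hind1.1.mul_left _).add hind0.1
  refine summable_and_tsum_le_of_le (fun x => mul_nonneg (abs_nonneg _) (Real.exp_pos _).le) (fun x => ?_) hG ?_
  · simp only [idK_apply, and_true]
    by_cases h0 : x = y
    · have h1 : ¬ (x + unitVec α = y) := by rw [h0]; exact add_unitVec_ne_self y α
      have h2 : ¬ (x = y - unitVec α) := by rw [h0]; exact hne.symm
      rw [if_neg h1, if_pos h0, if_neg h2, h0, weight_self]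
      norm_num
    · by_cases h1 : x + unitVec α = y
      · have hx : x = y - unitVec α := by rw [← h1, add_sub_cancel_right]
        rw [if_pos h1, if_neg h0, if_pos hx, hx, l1_sub_symm, sub_sub_cancel, l1_unitVec]
        norm_num
      · rw [if_neg h1, if_neg h0, sub_self, abs_zero, zero_mul]
        positivity
  · rw [(hind1.1.mul_left _).tsum_add hind0.1, tsum_mul_left]
    nlinarith [hind1.2, hind0.2, Real.exp_pos s]

section Legs

variable (n : ℕ) [NeZero n] (a : ℝ)

omit [NeZero n] in
/-- [folklore] **THE MULTIPLIER PROJECTOR's GRADIENT LETTER** from `P`'s: `ColMass (∇_α R) s (1 + e^{s} + p₁)`. -/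
theorem colMass_rowGrad_Rgt {s p₁ : ℝ} (α : Fin 4)
    (hP₁ : ColMass (fun x y (v w : Unit) => Pgt n a (x + unitVec α) y v w - Pgt n a x y v w) s p₁) :
    ColMass (fun x y (v w : Unit) => Rgt n a (x + unitVec α) y v w - Rgt n a x y v w) s (1 + Real.exp s + p₁) := by
  rw [show Rgt n a = idK - Pgt n a by rw [Pgt_eq_idK_sub, sub_sub_cancel], rowGrad_sub]
  exact (colMass_rowGrad_idK s α).sub hP₁

/-- [folklore] `R ∘ G′ = G′ − P ∘ G′` (tame factors). -/
theorem comp_Rgt_Ggh_eq (ha : 0 < a) : comp (Rgt n a) (Ggh n a) = Ggh n a - comp (Pgt n a) (Ggh n a) := by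
  have hI : Tame (idK : MKer 4 Unit) := (spr_idK).tame
  rw [show Rgt n a = idK - Pgt n a by rw [Pgt_eq_idK_sub, sub_sub_cancel],
    comp_sub_left_tame hI (spr_Pgt n a ha).tame (tame_Ggh n a ha), comp_idK_left]

/-- [folklore] **THE `R∘G′` GRADIENT LETTER** from the legs': `ColMass (∇_α (R∘G′)) s (g₁ + p₁·g₀)` (`∇_α(R∘G′) = ∇_αG′ − (∇_αP)∘G′`,
`colMass_comp`). -/
theorem colMass_rowGrad_comp_Rgt_Ggh (ha : 0 < a) {s g₀ g₁ p₁ : ℝ} (hs : 0 ≤ s) (α : Fin 4) (hG₀ : ColMass (Ggh n a) s g₀)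
    (hG₁ : ColMass (fun x y (v w : Unit) => Ggh n a (x + unitVec α) y v w - Ggh n a x y v w) s g₁)
    (hP₁ : ColMass (fun x y (v w : Unit) => Pgt n a (x + unitVec α) y v w - Pgt n a x y v w) s p₁) :
    ColMass (fun x y (v w : Unit) => comp (Rgt n a) (Ggh n a) (x + unitVec α) y v w - comp (Rgt n a) (Ggh n a) x y v w)
      s (g₁ + p₁ * g₀) := by
  rw [comp_Rgt_Ggh_eq n a ha, rowGrad_sub, rowGrad_comp (spr_Pgt n a ha).tame (tame_Ggh n a ha)]
  exact hG₁.sub (colMass_comp hP₁ hG₀ hs)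

/-! ## §4 The (C1) row at one scale from three leg letters -/

/-- [folklore] **THE (C1) REDUCTION IN THE LEG CURRENCY**: at one scale `n`, rate `s ≥ 0`, from the column mass `g₀` of `Ggh n a`, the
column masses `g₁` of its four row-gradients and the column masses `p₁` of the four row-gradients of `Pgt n a`, PART 14's (C1)
summand (`RoadEndBFxRoadScalesS.d1Rep_BFx_road_scales_sbpS`, binders `hTs hTm`, at `s := σV∕n`) is summable with
`Σ'_{(p,q)} Σ_{gf} |tBw₁ n a κ u p q g f|·e^{s(|p−u|₁+|q−u|₁)} ≤ 16·e^{s}·(8·n²·p₁·(g₁ + p₁·g₀) + (1 + e^{s} + p₁))`. -/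
theorem tBw₁_weighted_mass_le_of_leg_letters (κ : Fin 4) (u : Site 4) (ha : 0 < a) {s g₀ g₁ p₁ : ℝ} (hs : 0 ≤ s)
    (hG₀ : ColMass (Ggh n a) s g₀)
    (hG₁ : ∀ α : Fin 4, ColMass (fun x y (v w : Unit) => Ggh n a (x + unitVec α) y v w - Ggh n a x y v w) s g₁)
    (hP₁ : ∀ α : Fin 4, ColMass (fun x y (v w : Unit) => Pgt n a (x + unitVec α) y v w - Pgt n a x y v w) s p₁) :
    (Summable fun p : Site 4 × Site 4 => ∑ g, ∑ f, |tBw₁ n a κ u p.1 p.2 g f| * Real.exp (s * (l1 (p.1 - u) + l1 (p.2 - u)))) ∧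
    ∑' p : Site 4 × Site 4, ∑ g, ∑ f, |tBw₁ n a κ u p.1 p.2 g f| * Real.exp (s * (l1 (p.1 - u) + l1 (p.2 - u)))
      ≤ 16 * Real.exp s * (8 * (n : ℝ) ^ 2 * (p₁ * (g₁ + p₁ * g₀)) + (1 + Real.exp s + p₁)) := by
  have hPc := colLetter_of_colMass hP₁
  have hRGc := colLetter_of_colMass (fun α => colMass_rowGrad_comp_Rgt_Ggh n a ha hs α hG₀ (hG₁ α) (hP₁ α))
  have hRc := colLetter_of_colMass (fun α => colMass_rowGrad_Rgt n a α (hP₁ α))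
  have h := tBw₁_weighted_mass_le_of_col κ u n a ha hs hPc hRGc hRc
  refine ⟨h.1, h.2.trans (le_of_eq ?_)⟩
  ring

end Legs

end Summit.QuantumFields.BalabanUV.Beta.D1BFx.CoframeJetDipoleLetters

end
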